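import Literature.Analysis.FluidPDE.TaoY6KernelNorms
import Literature.Analysis.FluidPDE.LocalBiotSavartCalculus
import Literature.Analysis.FluidPDE.EnergyToolkit
import HarnessLib

/-!
# The local Biot–Savart representation `u = -H + V` at a Whitney scale and its two bounds

Analysis/FluidPDE support file for the discharge of the named fact
`Literature.Analysis.FluidPDE.tao2011_nonlinearEstimate` (Tao 2011, §10, proof of Thm. 10.1,
estimate of the nonlinear term `Y₆`, arXiv:1108.1165 p. 32: "we first observe from the
divergence-free nature of `u` that `Δu = ∇ × ∇ × u` […] On `2Bᵢ`, we thus have the local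
Biot-Savart law `u = O(Δ⁻¹∇(ψᵢω)) + v` where `v` is harmonic on `2Bᵢ` […]
`‖∇v‖_{L^∞(Bᵢ)} ≲ rᵢ^{-3/2}‖ω‖_{L²(2Bᵢ)} + rᵢ^{-5/2}‖u‖_{L²(2Bᵢ)}`").

We realise this at scale `r` with the truncated Newtonian kernel `Γ₀ = newtonNear r (2r)` and the
smooth compactly supported `λ = newtonFarLaplacian r (2r)` (`∫ Γ₀ Δφ = φ(0) - ∫ λ φ`,
`FluidPDE/NewtonPotential`): for a smooth divergence-free `u` with `ω = curl u`,

  `u(y) = -H(y) + V(y)`,  `H(y) = ∫ Γ₀(z) curl ω (y - z) dz`,  `V(y) = ∫ λ(z) u(y - z) dz`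

(`eq_neg_newtonNearField_add_farField`; `Δu = -curl curl u`, `FluidPDE/LocalBiotSavartCalculus`),
so `Du = -DH + DV`. The far field `V` plays the role of Tao's harmonic `v`, and instead of the mean
value property we have the explicit kernel bounds (integration by parts puts the derivative on `λ`)

  `‖DV(y)‖ ≤ s ∫‖Dλ‖ = s C₁/r`  (if `|u| ≤ s`),   `‖DV(y)‖ ≤ (∫‖Dλ‖²)^{1/2} ‖u‖_{L²} = C₂^{1/2} r^{-5/2} ‖u‖_{L²}`,

while the near field is controlled, by Cauchy–Schwarz only, through the *gradient* of the
vorticity on the ball of radius `2r`: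

  `‖H(y)‖² ≤ (∫ Γ₀²) · ‖curlCLM‖² ∫_{B̄(y,2r)} |Dω|²_F`,   `∫ Γ₀² = C_Γ r`.

(This replaces Tao's `F_i = |∇Δ⁻¹∇(ψᵢω)| + …`, an order-zero singular integral of `ω`, by an
order-`(-1)` potential of `∇ω`; the integration by parts in `y` that makes this sufficient is
carried out in `FluidPDE/TaoY6Piece`.)

## References

* T. Tao, *Localisation and compactness properties of the Navier–Stokes global regularity
  problem*, Anal. PDE 6 (2013) 25–107 = arXiv:1108.1165 (`Tao2011`), §10, proof of Thm. 10.1,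
  p. 32.
* D. Gilbarg, N. S. Trudinger, *Elliptic partial differential equations of second order*
  (2001), (2.16)–(2.17).
-/

noncomputable section

open MeasureTheory Set Filter Metric Function Real InnerProductSpace
open scoped RealInnerProductSpace ContDiff Laplacian

namespace Literature.Analysis.FluidPDE.TaoY6

section Representation

variable {r : ℝ} {u : EuclideanSpace ℝ (Fin 3) → EuclideanSpace ℝ (Fin 3)}

/-- The truncated kernel `Γ₀ = newtonNear r (2r)` vanishes off the ball of radius `2r`. [folklore] -/
theorem newtonNear_two_mul_eq_zero (hr : 0 < r) :
    ∀ z : EuclideanSpace ℝ (Fin 3), 2 * r < ‖z‖ → newtonNear r (2 * r) z = 0 :=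
  fun _ hz => newtonNear_eq_zero hr.le (lt_two_mul_self hr) hz.le

/-- The smoothing kernel `λ = newtonFarLaplacian r (2r)` vanishes off the ball of radius `2r`.
[folklore] -/
theorem newtonFarLaplacian_two_mul_eq_zero (hr : 0 < r) :
    ∀ z : EuclideanSpace ℝ (Fin 3), 2 * r < ‖z‖ → newtonFarLaplacian r (2 * r) z = 0 :=
  fun _ hz => newtonFarLaplacian_eq_zero_of_gt hr.le (lt_two_mul_self hr) hz

/-- **The local Biot–Savart representation, coordinate form.** For a divergence-free `C²` field
`u` on `ℝ³`, every point `y`, radius `r > 0` and coordinate `m`: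
`uₘ(y) = -∫ Γ₀(z) (curl curl u)ₘ(y - z) dz + ∫ λ(z) uₘ(y - z) dz`
(Green's representation `∫ Γ₀ Δφ = φ(0) - ∫ λφ` applied to `φ = uₘ(y - ·)`, with
`Δu = -curl curl u`; Tao: "`Δu = ∇ × ∇ × u` […] the local Biot-Savart law"). [cite: Tao2011, §10, proof of Thm. 10.1 (p. 32)] -/
theorem apply_eq_neg_integral_newtonNear_add (hr : 0 < r) (hu : ContDiff ℝ 2 u)
    (hdiv : VectorCalculus.IsDivFree u) (y : EuclideanSpace ℝ (Fin 3)) (m : Fin 3) :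
    u y m = -(∫ z, newtonNear r (2 * r) z * curl (curl u) (y - z) m) +
      ∫ z, newtonFarLaplacian r (2 * r) z * u (y - z) m := by
  set φ : EuclideanSpace ℝ (Fin 3) → ℝ := fun z => u (y - z) m with hφ
  have hum : ContDiff ℝ 2 fun x => u x m := contDiff_apply_coord hu m
  have hφ2 : ContDiff ℝ 2 φ := hum.comp (contDiff_const.sub contDiff_id)
  have hrep := integral_newtonNear_mul_laplacian hr (lt_two_mul_self hr) hφ2
  have hΔ : ∀ z, (Δ φ) z = -(curl (curl u) (y - z) m) := fun z => by
    rw [hφ, show (fun z => u (y - z) m) = fun w => (fun x => u x m) (y - w) from rfl,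
      laplacian_comp_const_sub (fun x => u x m) y z, laplacian_coord_eq_neg_curl_curl hu hdiv]
  simp_rw [hΔ, mul_neg, integral_neg] at hrep
  have h0 : φ 0 = u y m := by simp [hφ]
  rw [h0] at hrep
  linarith

/-- Integrability of `z ↦ Γ₀(z) • g(y - z)` for continuous `g`. [folklore] -/
theorem integrable_newtonNear_smul_comp_sub (hr : 0 < r)
    {g : EuclideanSpace ℝ (Fin 3) → EuclideanSpace ℝ (Fin 3)} (hg : Continuous g)
    (y : EuclideanSpace ℝ (Fin 3)) :
    Integrable fun z => newtonNear r (2 * r) z • g (y - z) :=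
  integrable_smul_comp_sub (integrable_newtonNear hr.le (lt_two_mul_self hr))
    (newtonNear_two_mul_eq_zero hr) hg y

/-- Integrability of `z ↦ λ(z) • g(y - z)` for continuous `g`. [folklore] -/
theorem integrable_newtonFarLaplacian_smul_comp_sub (hr : 0 < r)
    {g : EuclideanSpace ℝ (Fin 3) → EuclideanSpace ℝ (Fin 3)} (hg : Continuous g)
    (y : EuclideanSpace ℝ (Fin 3)) :
    Integrable fun z => newtonFarLaplacian r (2 * r) z • g (y - z) :=
  integrable_smul_comp_sub (integrable_newtonFarLaplacian hr (lt_two_mul_self hr))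
    (newtonFarLaplacian_two_mul_eq_zero hr) hg y

/-- Components of a Bochner integral in `ℝ³`. [folklore] -/
theorem integral_apply_coord {f : EuclideanSpace ℝ (Fin 3) → EuclideanSpace ℝ (Fin 3)}
    (hf : Integrable f) (m : Fin 3) : (∫ z, f z) m = ∫ z, f z m := by
  have h := ((EuclideanSpace.proj m : EuclideanSpace ℝ (Fin 3) →L[ℝ] ℝ).integral_comp_comm hf)
  simpa using h.symm

/-- **The local Biot–Savart representation `u = -H + V`** (vector form): for a divergence-free
`C²` field, `u(y) = -∫ Γ₀(z) curl curl u (y - z) dz + ∫ λ(z) u(y - z) dz`. [cite: Tao2011, §10, proof of Thm. 10.1 (p. 32)] -/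
theorem eq_neg_newtonNearField_add_farField (hr : 0 < r) (hu : ContDiff ℝ 2 u)
    (hdiv : VectorCalculus.IsDivFree u) (y : EuclideanSpace ℝ (Fin 3)) :
    u y = -(∫ z, newtonNear r (2 * r) z • curl (curl u) (y - z)) +
      ∫ z, newtonFarLaplacian r (2 * r) z • u (y - z) := by
  have hcc : Continuous (curl (curl u)) :=
    continuous_curl (contDiff_curl (n := 1) (by exact_mod_cast hu))
  ext m
  rw [PiLp.add_apply, PiLp.neg_apply,
    integral_apply_coord (integrable_newtonNear_smul_comp_sub hr hcc y),
    integral_apply_coord (integrable_newtonFarLaplacian_smul_comp_sub hr hu.continuous y)]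
  simp only [PiLp.smul_apply, smul_eq_mul]
  exact apply_eq_neg_integral_newtonNear_add hr hu hdiv y m

/-- The near field `H = ∫ Γ₀(z) curl curl u (· - z) dz` is `C¹` when `u ∈ C⁴`. [folklore] -/
theorem contDiff_one_newtonNearField (hr : 0 < r) (hu : ContDiff ℝ 4 u) :
    ContDiff ℝ 1 fun y => ∫ z, newtonNear r (2 * r) z • curl (curl u) (y - z) := by
  have hcc : ContDiff ℝ 1 (curl (curl u)) := by
    have h3 : ContDiff ℝ 3 u := hu.of_le (by norm_cast)
    exact contDiff_curl (n := 1) (contDiff_curl (n := 2) h3)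
  exact contDiff_integral_smul_comp_sub (integrable_newtonNear hr.le (lt_two_mul_self hr))
    (newtonNear_two_mul_eq_zero hr) 1 (by exact_mod_cast hcc)

/-- The far field `V = ∫ λ(z) u(· - z) dz` is `C¹` when `u ∈ C¹`. [folklore] -/
theorem contDiff_one_farField (hr : 0 < r) (hu : ContDiff ℝ 1 u) :
    ContDiff ℝ 1 fun y => ∫ z, newtonFarLaplacian r (2 * r) z • u (y - z) :=
  contDiff_integral_smul_comp_sub (integrable_newtonFarLaplacian hr (lt_two_mul_self hr))
    (newtonFarLaplacian_two_mul_eq_zero hr) 1 (by exact_mod_cast hu)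

/-- **`Du = -DH + DV`**: the derivative of the local Biot–Savart representation. [cite: Tao2011, §10, proof of Thm. 10.1 (p. 32)] -/
theorem fderiv_eq_neg_fderiv_newtonNearField_add (hr : 0 < r) (hu : ContDiff ℝ 4 u)
    (hdiv : VectorCalculus.IsDivFree u) (y : EuclideanSpace ℝ (Fin 3)) :
    fderiv ℝ u y = -fderiv ℝ (fun y => ∫ z, newtonNear r (2 * r) z • curl (curl u) (y - z)) y +
      fderiv ℝ (fun y => ∫ z, newtonFarLaplacian r (2 * r) z • u (y - z)) y := by
  have hu2 : ContDiff ℝ 2 u := hu.of_le (by norm_cast)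
  have hu1 : ContDiff ℝ 1 u := hu.of_le (by norm_cast)
  have hfun : u = fun y => -(∫ z, newtonNear r (2 * r) z • curl (curl u) (y - z)) +
      ∫ z, newtonFarLaplacian r (2 * r) z • u (y - z) :=
    funext fun y => eq_neg_newtonNearField_add_farField hr hu2 hdiv y
  have hH := (contDiff_one_newtonNearField hr hu).differentiable one_ne_zero y
  have hV := (contDiff_one_farField hr hu1).differentiable one_ne_zero y
  conv_lhs => rw [hfun]
  rw [fderiv_fun_add hH.fun_neg hV, fderiv_fun_neg]

end Representation

/-! ### The far field: integration by parts onto the kernel, and the two bounds -/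

section FarField

variable {r : ℝ} {u : EuclideanSpace ℝ (Fin 3) → EuclideanSpace ℝ (Fin 3)}

/-- **Derivative of the far field**: `DV(y) a = ∫ (Dλ(z) a) u(y - z) dz` (differentiate under the
integral and integrate by parts in `z`; the derivative lands on the smooth kernel `λ`). [folklore] -/
theorem fderiv_farField_apply (hr : 0 < r) (hu : ContDiff ℝ 1 u) (y a : EuclideanSpace ℝ (Fin 3)) :
    fderiv ℝ (fun y => ∫ z, newtonFarLaplacian r (2 * r) z • u (y - z)) y a =
      ∫ z, (fderiv ℝ (newtonFarLaplacian r (2 * r)) z a) • u (y - z) := by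
  have hr2 := lt_two_mul_self hr
  have hlam : ContDiff ℝ 1 (newtonFarLaplacian r (2 * r)) := contDiff_newtonFarLaplacian hr hr2
  have hlamc : HasCompactSupport (newtonFarLaplacian r (2 * r)) :=
    hasCompactSupport_newtonFarLaplacian hr.le hr2
  rw [fderiv_integral_smul_comp_sub_apply (integrable_newtonFarLaplacian hr hr2)
    (newtonFarLaplacian_two_mul_eq_zero hr) hu y a]
  -- integrate by parts: the total derivative of `z ↦ λ(z) • u(y - z)` integrates to zero
  have huy : ContDiff ℝ 1 fun z => u (y - z) := hu.comp (contDiff_const.sub contDiff_id)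
  have hP : ContDiff ℝ 1 fun z => newtonFarLaplacian r (2 * r) z • u (y - z) := hlam.smul huy
  have hPc : HasCompactSupport fun z => newtonFarLaplacian r (2 * r) z • u (y - z) :=
    hlamc.smul_right
  have h0 := integral_fderiv_apply_eq_zero hP hPc a
  have hpt : ∀ z, fderiv ℝ (fun z => newtonFarLaplacian r (2 * r) z • u (y - z)) z a =
      (fderiv ℝ (newtonFarLaplacian r (2 * r)) z a) • u (y - z) -
        newtonFarLaplacian r (2 * r) z • fderiv ℝ u (y - z) a := fun z => by
    rw [fderiv_fun_smul (hlam.differentiable one_ne_zero z) (huy.differentiable one_ne_zero z),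
      fderiv_comp_const_sub]
    simp only [_root_.add_apply, _root_.FunLike.coe_smul, Pi.smul_apply, _root_.neg_apply,
      ContinuousLinearMap.smulRight_apply, smul_neg]
    abel
  simp_rw [hpt] at h0
  have i1 : Integrable fun z => (fderiv ℝ (newtonFarLaplacian r (2 * r)) z a) • u (y - z) :=
    (((hlam.continuous_fderiv one_ne_zero).clm_apply continuous_const).smul huy.continuous)
      |>.integrable_of_hasCompactSupport (hlamc.fderiv_apply (𝕜 := ℝ) a).smul_right
  have i2 : Integrable fun z => newtonFarLaplacian r (2 * r) z • fderiv ℝ u (y - z) a :=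
    (hlam.continuous.smul (((hu.continuous_fderiv one_ne_zero).clm_apply continuous_const).comp
      (continuous_const.sub continuous_id))).integrable_of_hasCompactSupport hlamc.smul_right
  rw [integral_sub i1 i2, sub_eq_zero] at h0
  exact h0.symm

/-- **The `L^∞` bound for the far-field gradient** (Tao: `r^{-3/2}‖u‖_{L²(2Bᵢ)} ≲ ‖u‖_{L^∞}`,
the case of balls in the layer): if `‖u‖ ≤ s` everywhere then
`‖DV(y) a‖ ≤ (∫ ‖Dλ‖) s ‖a‖`. [cite: Tao2011, §10, proof of Thm. 10.1 (p. 32)] -/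
theorem norm_fderiv_farField_apply_le_of_bound (hr : 0 < r) (hu : ContDiff ℝ 1 u) {s : ℝ}
    (hs : ∀ x, ‖u x‖ ≤ s) (y a : EuclideanSpace ℝ (Fin 3)) :
    ‖fderiv ℝ (fun y => ∫ z, newtonFarLaplacian r (2 * r) z • u (y - z)) y a‖ ≤
      (∫ z, ‖fderiv ℝ (newtonFarLaplacian r (2 * r)) z‖) * s * ‖a‖ := by
  have hr2 := lt_two_mul_self hr
  rw [fderiv_farField_apply hr hu y a]
  have hs0 : 0 ≤ s := (norm_nonneg _).trans (hs 0)
  calc ‖∫ z, (fderiv ℝ (newtonFarLaplacian r (2 * r)) z a) • u (y - z)‖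
      ≤ ∫ z, ‖(fderiv ℝ (newtonFarLaplacian r (2 * r)) z a) • u (y - z)‖ :=
        norm_integral_le_integral_norm _
    _ ≤ ∫ z, ‖fderiv ℝ (newtonFarLaplacian r (2 * r)) z‖ * (s * ‖a‖) := by
        refine integral_mono_of_nonneg (Eventually.of_forall fun z => norm_nonneg _)
          ((integrable_norm_fderiv_newtonFarLaplacian hr hr2).mul_const _)
          (Eventually.of_forall fun z => ?_)
        dsimp only
        rw [norm_smul]
        calc ‖fderiv ℝ (newtonFarLaplacian r (2 * r)) z a‖ * ‖u (y - z)‖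
            ≤ (‖fderiv ℝ (newtonFarLaplacian r (2 * r)) z‖ * ‖a‖) * s :=
              mul_le_mul (ContinuousLinearMap.le_opNorm _ _) (hs _) (norm_nonneg _)
                (mul_nonneg (norm_nonneg _) (norm_nonneg _))
          _ = ‖fderiv ℝ (newtonFarLaplacian r (2 * r)) z‖ * (s * ‖a‖) := by ring
    _ = (∫ z, ‖fderiv ℝ (newtonFarLaplacian r (2 * r)) z‖) * s * ‖a‖ := by
        rw [integral_mul_const]; ring

/-- **The `L²` bound for the far-field gradient** (Tao: "`‖∇v‖_{L^∞(Bᵢ)} ≲ r_i^{-5/2}‖u‖_{L²(2Bᵢ)}`"):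
if `‖u‖² ∈ L¹` then `‖DV(y) a‖ ≤ (∫‖Dλ‖²)^{1/2} (∫‖u‖²)^{1/2} ‖a‖`. [cite: Tao2011, §10, proof of Thm. 10.1 (p. 32)] -/
theorem norm_fderiv_farField_apply_le_sqrt (hr : 0 < r) (hu : ContDiff ℝ 1 u)
    (hu2 : Integrable fun x => ‖u x‖ ^ 2) (y a : EuclideanSpace ℝ (Fin 3)) :
    ‖fderiv ℝ (fun y => ∫ z, newtonFarLaplacian r (2 * r) z • u (y - z)) y a‖ ≤
      Real.sqrt (∫ z, ‖fderiv ℝ (newtonFarLaplacian r (2 * r)) z‖ ^ 2) *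
        Real.sqrt (∫ x, ‖u x‖ ^ 2) * ‖a‖ := by
  have hr2 := lt_two_mul_self hr
  rw [fderiv_farField_apply hr hu y a]
  -- `z ↦ u (y - z)` is in `L²` with the same norm as `u`
  have huy : Integrable fun z => ‖u (y - z)‖ ^ 2 := by
    have := ((hu2.comp_sub_left y))
    exact this
  have hmu : MemLp (fun z => u (y - z)) 2 (volume : Measure (EuclideanSpace ℝ (Fin 3))) :=
    (memLp_two_iff_integrable_sq_norm
      ((hu.continuous.comp (continuous_const.sub continuous_id)).aestronglyMeasurable)).2 huy
  have hmlam : MemLp (fderiv ℝ (newtonFarLaplacian r (2 * r))) 2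
      (volume : Measure (EuclideanSpace ℝ (Fin 3))) :=
    (memLp_two_iff_integrable_sq_norm
      (continuous_fderiv_newtonFarLaplacian hr hr2).aestronglyMeasurable).2
      (integrable_sq_norm_fderiv_newtonFarLaplacian hr hr2)
  have hCS := integral_norm_mul_norm_le_sqrt_mul_sqrt hmlam hmu
  have heq : ∫ z, ‖u (y - z)‖ ^ 2 = ∫ x, ‖u x‖ ^ 2 := by
    have := integral_sub_left_eq_self (fun x => ‖u x‖ ^ 2) volume y
    exact this
  rw [heq] at hCS
  calc ‖∫ z, (fderiv ℝ (newtonFarLaplacian r (2 * r)) z a) • u (y - z)‖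
      ≤ ∫ z, ‖(fderiv ℝ (newtonFarLaplacian r (2 * r)) z a) • u (y - z)‖ :=
        norm_integral_le_integral_norm _
    _ ≤ ∫ z, ‖fderiv ℝ (newtonFarLaplacian r (2 * r)) z‖ * ‖u (y - z)‖ * ‖a‖ := by
        refine integral_mono_of_nonneg (Eventually.of_forall fun z => norm_nonneg _)
          ?_ (Eventually.of_forall fun z => ?_)
        · have := (hmlam.norm.integrable_mul hmu.norm).mul_const ‖a‖
          simpa only [Pi.mul_def] using this
        · dsimp only
          rw [norm_smul]
          calc ‖fderiv ℝ (newtonFarLaplacian r (2 * r)) z a‖ * ‖u (y - z)‖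
              ≤ (‖fderiv ℝ (newtonFarLaplacian r (2 * r)) z‖ * ‖a‖) * ‖u (y - z)‖ :=
                mul_le_mul_of_nonneg_right (ContinuousLinearMap.le_opNorm _ _) (norm_nonneg _)
            _ = ‖fderiv ℝ (newtonFarLaplacian r (2 * r)) z‖ * ‖u (y - z)‖ * ‖a‖ := by ring
    _ = (∫ z, ‖fderiv ℝ (newtonFarLaplacian r (2 * r)) z‖ * ‖u (y - z)‖) * ‖a‖ :=
        integral_mul_const _ _
    _ ≤ Real.sqrt (∫ z, ‖fderiv ℝ (newtonFarLaplacian r (2 * r)) z‖ ^ 2) *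
          Real.sqrt (∫ x, ‖u x‖ ^ 2) * ‖a‖ :=
        mul_le_mul_of_nonneg_right hCS (norm_nonneg _)

/-- Operator-norm form of `norm_fderiv_farField_apply_le_of_bound`: `‖DV(y)‖ ≤ (∫‖Dλ‖) s`. [folklore] -/
theorem opNorm_fderiv_farField_le_of_bound (hr : 0 < r) (hu : ContDiff ℝ 1 u) {s : ℝ}
    (hs : ∀ x, ‖u x‖ ≤ s) (y : EuclideanSpace ℝ (Fin 3)) :
    ‖fderiv ℝ (fun y => ∫ z, newtonFarLaplacian r (2 * r) z • u (y - z)) y‖ ≤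
      (∫ z, ‖fderiv ℝ (newtonFarLaplacian r (2 * r)) z‖) * s := by
  have hs0 : 0 ≤ s := (norm_nonneg _).trans (hs 0)
  refine ContinuousLinearMap.opNorm_le_bound _
    (mul_nonneg (integral_norm_fderiv_newtonFarLaplacian_nonneg _ _) hs0) fun a => ?_
  exact norm_fderiv_farField_apply_le_of_bound hr hu hs y a

/-- Operator-norm form of `norm_fderiv_farField_apply_le_sqrt`:
`‖DV(y)‖ ≤ (∫‖Dλ‖²)^{1/2} (∫‖u‖²)^{1/2}`. [folklore] -/
theorem opNorm_fderiv_farField_le_sqrt (hr : 0 < r) (hu : ContDiff ℝ 1 u)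
    (hu2 : Integrable fun x => ‖u x‖ ^ 2) (y : EuclideanSpace ℝ (Fin 3)) :
    ‖fderiv ℝ (fun y => ∫ z, newtonFarLaplacian r (2 * r) z • u (y - z)) y‖ ≤
      Real.sqrt (∫ z, ‖fderiv ℝ (newtonFarLaplacian r (2 * r)) z‖ ^ 2) *
        Real.sqrt (∫ x, ‖u x‖ ^ 2) := by
  refine ContinuousLinearMap.opNorm_le_bound _
    (mul_nonneg (Real.sqrt_nonneg _) (Real.sqrt_nonneg _)) fun a => ?_
  exact norm_fderiv_farField_apply_le_sqrt hr hu hu2 y a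

end FarField

/-! ### The near field: Cauchy–Schwarz against `Γ₀ ∈ L²` -/

section NearField

variable {r : ℝ}

/-- Reflected translates of a continuous function are square integrable on the support ball of
the kernel, with `∫_{|z| ≤ R} ‖g(y - z)‖² dz = ∫_{B̄(y, R)} ‖g‖²`. [folklore] -/
theorem setIntegral_closedBall_sq_norm_comp_sub {F : Type*} [NormedAddCommGroup F]
    (g : EuclideanSpace ℝ (Fin 3) → F) (y : EuclideanSpace ℝ (Fin 3)) (R : ℝ) :
    ∫ z in closedBall (0 : EuclideanSpace ℝ (Fin 3)) R, ‖g (y - z)‖ ^ 2 =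
      ∫ x in closedBall y R, ‖g x‖ ^ 2 := by
  have h1 : ∫ z in closedBall (0 : EuclideanSpace ℝ (Fin 3)) R, ‖g (y - z)‖ ^ 2 =
      ∫ z, (closedBall (0 : EuclideanSpace ℝ (Fin 3)) R).indicator (fun z => ‖g (y - z)‖ ^ 2) z :=
    (integral_indicator measurableSet_closedBall).symm
  have h2 : ∫ x in closedBall y R, ‖g x‖ ^ 2 =
      ∫ x, (closedBall y R).indicator (fun x => ‖g x‖ ^ 2) x :=
    (integral_indicator measurableSet_closedBall).symm
  rw [h1, h2, ← integral_sub_left_eq_self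
    (fun x => (closedBall y R).indicator (fun x => ‖g x‖ ^ 2) x) volume y]
  refine integral_congr_ae (Eventually.of_forall fun z => ?_)
  simp only [indicator]
  have hmem : z ∈ closedBall (0 : EuclideanSpace ℝ (Fin 3)) R ↔ y - z ∈ closedBall y R := by
    rw [mem_closedBall_zero_iff, mem_closedBall, dist_eq_norm, sub_sub_cancel_left, norm_neg]
  by_cases hz : z ∈ closedBall (0 : EuclideanSpace ℝ (Fin 3)) R
  · rw [if_pos hz, if_pos (hmem.1 hz)]
  · rw [if_neg hz, if_neg (fun h => hz (hmem.2 h))]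

/-- **The near-field bound**: for a continuous `g` and `Γ₀ = newtonNear r (2r)`,
`‖∫ Γ₀(z) g(y - z) dz‖² ≤ (∫ Γ₀²) ∫_{B̄(y,2r)} ‖g‖²` (Cauchy–Schwarz; `Γ₀` is supported in
`|z| ≤ 2r`). [folklore] -/
theorem norm_sq_integral_newtonNear_smul_le (hr : 0 < r) {F : Type*} [NormedAddCommGroup F]
    [NormedSpace ℝ F] {g : EuclideanSpace ℝ (Fin 3) → F} (hg : Continuous g)
    (y : EuclideanSpace ℝ (Fin 3)) :
    ‖∫ z, newtonNear r (2 * r) z • g (y - z)‖ ^ 2 ≤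
      (∫ z, newtonNear r (2 * r) z ^ 2) * ∫ x in closedBall y (2 * r), ‖g x‖ ^ 2 := by
  have hr2 := lt_two_mul_self hr
  set gB : EuclideanSpace ℝ (Fin 3) → F :=
    (closedBall (0 : EuclideanSpace ℝ (Fin 3)) (2 * r)).indicator fun z => g (y - z) with hgB
  -- the kernel only sees `g` on the ball
  have hpt : ∀ z, newtonNear r (2 * r) z • g (y - z) = newtonNear r (2 * r) z • gB z := by
    intro z
    by_cases hz : z ∈ closedBall (0 : EuclideanSpace ℝ (Fin 3)) (2 * r)
    · rw [hgB, indicator_of_mem hz]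
    · rw [hgB, indicator_of_notMem hz, smul_zero]
      rw [mem_closedBall_zero_iff, not_le] at hz
      rw [newtonNear_eq_zero hr.le hr2 hz.le, zero_smul]
  -- `gB ∈ L²`
  have hgyc : Continuous fun z => g (y - z) := hg.comp (continuous_const.sub continuous_id)
  have hgBm : AEStronglyMeasurable gB volume :=
    hgyc.aestronglyMeasurable.indicator measurableSet_closedBall
  have heq2 : (fun z => ‖gB z‖ ^ 2) =
      (closedBall (0 : EuclideanSpace ℝ (Fin 3)) (2 * r)).indicator fun z => ‖g (y - z)‖ ^ 2 := by
    funext z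
    by_cases hz : z ∈ closedBall (0 : EuclideanSpace ℝ (Fin 3)) (2 * r)
    · rw [hgB, indicator_of_mem hz, indicator_of_mem hz]
    · rw [hgB, indicator_of_notMem hz, indicator_of_notMem hz, norm_zero, zero_pow two_ne_zero]
  have hgB2 : Integrable fun z => ‖gB z‖ ^ 2 := by
    have hint : IntegrableOn (fun z => ‖g (y - z)‖ ^ 2)
        (closedBall (0 : EuclideanSpace ℝ (Fin 3)) (2 * r)) volume :=
      (hgyc.norm.pow 2).continuousOn.integrableOn_compact (isCompact_closedBall _ _)
    rw [heq2]
    exact hint.integrable_indicator measurableSet_closedBall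
  have hmg : MemLp gB 2 (volume : Measure (EuclideanSpace ℝ (Fin 3))) :=
    (memLp_two_iff_integrable_sq_norm hgBm).2 hgB2
  have hmGam : MemLp (newtonNear r (2 * r)) 2 (volume : Measure (EuclideanSpace ℝ (Fin 3))) :=
    memLp_two_newtonNear hr.le hr2
  have hCS := integral_norm_mul_norm_le_sqrt_mul_sqrt hmGam hmg
  have hgBint : ∫ z, ‖gB z‖ ^ 2 = ∫ x in closedBall y (2 * r), ‖g x‖ ^ 2 := by
    rw [← setIntegral_closedBall_sq_norm_comp_sub g y (2 * r), ← integral_indicator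
      measurableSet_closedBall, heq2]
  have hA : 0 ≤ ∫ z, newtonNear r (2 * r) z ^ 2 := integral_sq_newtonNear_nonneg _ _
  have hBnn : 0 ≤ ∫ x in closedBall y (2 * r), ‖g x‖ ^ 2 :=
    integral_nonneg fun _ => sq_nonneg _
  calc ‖∫ z, newtonNear r (2 * r) z • g (y - z)‖ ^ 2
      = ‖∫ z, newtonNear r (2 * r) z • gB z‖ ^ 2 := by simp_rw [hpt]
    _ ≤ (∫ z, ‖newtonNear r (2 * r) z • gB z‖) ^ 2 :=
        pow_le_pow_left₀ (norm_nonneg _) (norm_integral_le_integral_norm _) 2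
    _ = (∫ z, ‖newtonNear r (2 * r) z‖ * ‖gB z‖) ^ 2 := by simp_rw [norm_smul]
    _ ≤ (Real.sqrt (∫ z, ‖newtonNear r (2 * r) z‖ ^ 2) * Real.sqrt (∫ z, ‖gB z‖ ^ 2)) ^ 2 :=
        pow_le_pow_left₀ (integral_nonneg fun _ => mul_nonneg (norm_nonneg _) (norm_nonneg _))
          hCS 2
    _ = (∫ z, newtonNear r (2 * r) z ^ 2) * ∫ x in closedBall y (2 * r), ‖g x‖ ^ 2 := by
        rw [mul_pow, hgBint, Real.sq_sqrt hBnn]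
        simp_rw [Real.norm_eq_abs, sq_abs]
        rw [Real.sq_sqrt hA]

end NearField


end Literature.Analysis.FluidPDE.TaoY6

end
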